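import Summits.BirchSwinnertonDyer.BirchSwinnertonDyer.Theorems.ManinLocalTwoThreeHexagonalSqueezeTwentySeven
import Literature.NumberTheory.EllipticCurves.PeriodLatticeRationalityLemmasProofs
import Literature.NumberTheory.EllipticCurves.ModularCurveEtaQuotientsProofs
import Literature.NumberTheory.EllipticCurves.UniformizationProofs
import HarnessLib

/-!
# The analytic bridge: a Weierstrass differential equation along `2πi∫f` puts `Λ(f)` inside `Λ`

Cell bsd-f2-manin, route `ManinLocalTwoThree`, toward (S2) of the hexagonal squeeze at `N = 27`
(`HexagonalSqueezeTwentySeven.abs_maninConstant_eq_one_twentySeven_of_periodLattice_le_hex`).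

THEOREM (`periodLattice_le_of_deriv_sq`).  Let `f ∈ S₂(Γ₀(N))`, `f ≠ 0`, let `Λ` be a period pair and
let `x : ℍ → ℂ` be holomorphic and `Γ₀(N)`-INVARIANT with
`x′(τ)² = (2πi f(τ))² (4x(τ)³ − g₂(Λ)x(τ) − g₃(Λ))` on `ℍ` and `4x³ − g₂x − g₃ ≢ 0`.  Then every period
of `f` lies in `Λ`: `Λ(f) ⊆ Λ`.  Proof: by the global uniqueness theorem for the Weierstrass equation
(the tree's `PeriodPair.exists_eq_weierstrassP_of_deriv_sq`, Whittaker–Watson §20.22) there are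
`ε = ±1`, `c ∈ ℂ` with `x = ℘_Λ(ε·ℰ_f + c)` off the poles, `ℰ_f = 2πi∫_{i∞} f`; for `γ ∈ Γ₀(N)`,
`ℰ_f(γτ) = ℰ_f(τ) + {∞,γ∞}_f` (`eichlerIntegral_smul_sub_holds`) and `x(γτ) = x(τ)` give
`℘_Λ(ζ(τ) + ε{∞,γ∞}) = ℘_Λ(ζ(τ))` along the non-constant analytic curve `ζ = εℰ_f + c`, so
`ε{∞,γ∞} ∈ Λ` (Manin's lemma, the tree's `PeriodPair.mem_lattice_of_weierstrassP_comp_add_eventuallyEq`).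
No pinning of the integration constant `c` and no behaviour at the cusps is needed.

This reduces (S2) `Λ(φ₂₇) ⊆ Λ(0, 27)` to exhibiting ONE `Γ₀(27)`-invariant holomorphic `x` with
`(x′)² = (2πiφ₂₇)²(4x³ − 27)` — Ligozat's `x = η(9τ)⁴/(η(3τ)η(27τ)³)` (see the sibling file
`…AnalyticBridgeTwentySeven`).
-/

set_option autoImplicit false
set_option linter.dupNamespace false

noncomputable section

open Complex Filter Topology Set Function
open UpperHalfPlane hiding I
open scoped Real Topology Manifold MatrixGroups ModularForm PeriodPair
open CongruenceSubgroup
open Literature.NumberTheory.EllipticCurves Literature.NumberTheory.EllipticCurves.ModularForms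

namespace Summit.BirchSwinnertonDyer.BirchSwinnertonDyer.Theorems.ManinLocalTwoThree.AnalyticBridge

variable {N : ℕ} [NeZero N]

/-- For `f ≠ 0`, `ε, c ∈ ℂ` and a period pair `Λ`, the set of `z` in the upper half-plane with
`ε ℰ_f(z) + c = l` is countable, for every `l` (a fibre of a non-constant analytic function on the
connected half-plane), unless `ε = 0`. [folklore] -/
theorem countable_setOf_eichlerIntegral_affine_eq (f : CuspForm (Gamma0 N) 2) (hf : f ≠ 0) {ε : ℂ}
    (hε : ε ≠ 0) (c l : ℂ) :
    {z : ℂ | 0 < z.im ∧ ε * eichlerIntegral f (ofComplex z) + c = l}.Countable := by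
  have hconn : IsConnected {z : ℂ | 0 < z.im} := by
    refine ⟨⟨Complex.I, by simp⟩, ?_⟩
    simpa using isPreconnected_diff_of_countable (T := ∅) convex_setOf_im_pos isOpen_upperHalfPlaneSet
      countable_empty
  have han : AnalyticOnNhd ℂ (fun w : ℂ ↦ eichlerIntegral f (ofComplex w)) {z : ℂ | 0 < z.im} :=
    fun z hz ↦ analyticAt_eichlerIntegral_comp_ofComplex f hz
  have heq : {z : ℂ | 0 < z.im ∧ ε * eichlerIntegral f (ofComplex z) + c = l} =
      {z : ℂ | 0 < z.im} ∩ (fun w : ℂ ↦ eichlerIntegral f (ofComplex w)) ⁻¹' {ε⁻¹ * (l - c)} := by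
    ext z
    simp only [mem_setOf_eq, mem_inter_iff, mem_preimage, mem_singleton_iff]
    constructor
    · rintro ⟨hz, h⟩
      refine ⟨hz, ?_⟩
      rw [← h]; field_simp; ring
    · rintro ⟨hz, h⟩
      refine ⟨hz, ?_⟩
      rw [h]; field_simp; ring
  rw [heq]
  by_cases hex : ∃ z : ℂ, 0 < z.im ∧ eichlerIntegral f (ofComplex z) ≠ ε⁻¹ * (l - c)
  · obtain ⟨z₁, hz₁, hne⟩ := hex
    exact countable_inter_preimage_singleton_of_analyticOnNhd han hconn hz₁ hne
  · simp only [not_exists, not_and, not_not] at hex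
    exfalso
    apply not_eventually_const_eichlerIntegral f hf (z := Complex.I) (by simp) (ε⁻¹ * (l - c))
    filter_upwards [isOpen_upperHalfPlaneSet.mem_nhds (show (0 : ℝ) < Complex.I.im by simp)] with w hw
    exact hex w hw

/-- For `f ≠ 0`, `ε ≠ 0`, the set of `z` in the upper half-plane with `ε ℰ_f(z) + c ∈ Λ` is countable.
[folklore] -/
theorem countable_setOf_eichlerIntegral_affine_mem (f : CuspForm (Gamma0 N) 2) (hf : f ≠ 0)
    (L : PeriodPair) {ε : ℂ} (hε : ε ≠ 0) (c : ℂ) :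
    {z : ℂ | 0 < z.im ∧ ε * eichlerIntegral f (ofComplex z) + c ∈ L.lattice}.Countable := by
  have hsub : {z : ℂ | 0 < z.im ∧ ε * eichlerIntegral f (ofComplex z) + c ∈ L.lattice} ⊆
      ⋃ l ∈ (L.lattice : Set ℂ), {z : ℂ | 0 < z.im ∧ ε * eichlerIntegral f (ofComplex z) + c = l} := by
    rintro z ⟨hz, hl⟩
    simp only [mem_iUnion, mem_setOf_eq, SetLike.mem_coe, exists_prop]
    exact ⟨_, hl, hz, rfl⟩
  exact (L.countable_lattice.biUnion fun l _ ↦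
    countable_setOf_eichlerIntegral_affine_eq f hf hε c l).mono hsub

/-- **Manin's lemma along a Weierstrass solution.**  Let `f ≠ 0` in `S₂(Γ₀(N))`, `Λ` a period pair,
`x : ℍ → ℂ` holomorphic with `x′(τ)² = (2πi f(τ))²(4x³ − g₂x − g₃)` on `ℍ` and `4x(τ₀)³ − g₂x(τ₀) − g₃ ≠ 0`
somewhere.  If `x(γτ) = x(τ)` for ONE `γ ∈ Γ₀(N)`, then `{∞, γ∞}_f ∈ Λ`.
[cite: Manin1972, Prop. 1.4] -/
theorem cuspSymbol_mem_of_deriv_sq (f : CuspForm (Gamma0 N) 2) (hf : f ≠ 0) (L : PeriodPair)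
    (x : ℍ → ℂ) (hx : MDifferentiable 𝓘(ℂ) 𝓘(ℂ) x)
    (hode : ∀ τ : ℍ, deriv (x ∘ ofComplex) τ ^ 2 =
      (2 * π * Complex.I * f τ) ^ 2 * (4 * x τ ^ 3 - L.g₂ * x τ - L.g₃))
    (hnd : ∃ τ₀ : ℍ, 4 * x τ₀ ^ 3 - L.g₂ * x τ₀ - L.g₃ ≠ 0)
    (γ : Gamma0 N) (hγ : ∀ τ : ℍ, x ((γ : SL(2, ℤ)) • τ) = x τ) :
    cuspSymbol f γ ∈ L.lattice := by
  set s : ℂ := cuspSymbol f γ with hs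
  set v : ℂ → ℂ := fun w ↦ eichlerIntegral f (ofComplex w) with hv
  set w : ℂ → ℂ := x ∘ ofComplex with hw
  -- analytic data on the half-plane
  have hwan : AnalyticOnNhd ℂ w {z : ℂ | 0 < z.im} :=
    (UpperHalfPlane.mdifferentiable_iff.mp hx).analyticOnNhd isOpen_upperHalfPlaneSet
  have hvan : AnalyticOnNhd ℂ v {z : ℂ | 0 < z.im} :=
    fun z hz ↦ analyticAt_eichlerIntegral_comp_ofComplex f hz
  have hode' : ∀ z ∈ {z : ℂ | 0 < z.im},
      deriv w z ^ 2 = deriv v z ^ 2 * (4 * w z ^ 3 - L.g₂ * w z - L.g₃) := by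
    intro z hz
    have h := hode ⟨z, hz⟩
    have hd : deriv v z = 2 * π * Complex.I * f ⟨z, hz⟩ := by
      rw [hv, deriv_eichlerIntegral_comp_ofComplex f hz, ofComplex_apply_of_im_pos hz]
    have hwz : w z = x ⟨z, hz⟩ := by
      simp only [hw, Function.comp_apply, ofComplex_apply_of_im_pos hz]
    rw [hd, hwz]
    exact h
  obtain ⟨τ₀, hτ₀⟩ := hnd
  have hz₀ : (τ₀ : ℂ) ∈ {z : ℂ | 0 < z.im} := τ₀.im_pos
  have h0 : 4 * w τ₀ ^ 3 - L.g₂ * w τ₀ - L.g₃ ≠ 0 := by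
    simpa [hw, ofComplex_apply] using hτ₀
  obtain ⟨ε, hε, c, -, hglob⟩ := L.exists_eq_weierstrassP_of_deriv_sq convex_setOf_im_pos
    isOpen_upperHalfPlaneSet isOpen_upperHalfPlaneSet subset_rfl (by simp) hwan hvan hode' hz₀ h0
  have hε0 : ε ≠ 0 := by rcases hε with rfl | rfl <;> norm_num
  -- the curve `ζ = ε ℰ_f + c`
  set ζ : ℂ → ℂ := fun z ↦ ε * v z + c with hζ
  have hvγ : ∀ τ : ℍ, v (((γ : SL(2, ℤ)) • τ : ℍ) : ℂ) = v τ + s := by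
    intro τ
    simp only [hv, ofComplex_apply]
    linear_combination eichlerIntegral_smul_sub_holds f γ τ
  have hζγ : ∀ τ : ℍ, ζ (((γ : SL(2, ℤ)) • τ : ℍ) : ℂ) = ε * s + ζ τ := by
    intro τ
    simp only [hζ, hvγ]
    ring
  have hwγ : ∀ τ : ℍ, w (((γ : SL(2, ℤ)) • τ : ℍ) : ℂ) = w τ := by
    intro τ
    simp only [hw, Function.comp_apply, ofComplex_apply]
    exact hγ τ
  -- the pointwise translation symmetry off the poles
  have hpt : ∀ τ : ℍ, ζ τ ∉ L.lattice → ε * s + ζ τ ∉ L.lattice →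
      ℘[L] (ε * s + ζ τ) = ℘[L] (ζ τ) := by
    intro τ h1 h2
    have e1 : w (((γ : SL(2, ℤ)) • τ : ℍ) : ℂ) = ℘[L] (ζ (((γ : SL(2, ℤ)) • τ : ℍ) : ℂ)) :=
      hglob _ ((γ : SL(2, ℤ)) • τ).im_pos (by show ζ _ ∉ L.lattice; rw [hζγ]; exact h2)
    have e2 : w τ = ℘[L] (ζ τ) := hglob _ τ.im_pos h1
    rw [← hζγ, ← e1, hwγ, e2]
  -- a good base point
  have hbad : ({z : ℂ | 0 < z.im ∧ ε * eichlerIntegral f (ofComplex z) + c ∈ L.lattice} ∪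
      {z : ℂ | 0 < z.im ∧ ε * eichlerIntegral f (ofComplex z) + (c + ε * s) ∈ L.lattice}).Countable :=
    (countable_setOf_eichlerIntegral_affine_mem f hf L hε0 c).union
      (countable_setOf_eichlerIntegral_affine_mem f hf L hε0 (c + ε * s))
  obtain ⟨z₀, hz₀', hz₀1, hz₀2⟩ :
      ∃ z₀ : ℂ, 0 < z₀.im ∧ ζ z₀ ∉ L.lattice ∧ ε * s + ζ z₀ ∉ L.lattice := by
    by_contra hne
    push Not at hne
    apply not_countable_of_isOpen isOpen_upperHalfPlaneSet ⟨Complex.I, by simp⟩ (hbad.mono ?_)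
    intro z hz
    by_cases h : ζ z ∈ L.lattice
    · exact Or.inl ⟨hz, h⟩
    · refine Or.inr ⟨hz, ?_⟩
      have := hne z hz h
      simp only [hζ] at this
      convert this using 1
      ring
  -- the symmetry holds near `z₀`
  have hζc : ContinuousOn ζ {z : ℂ | 0 < z.im} :=
    (continuousOn_const.mul (differentiableOn_eichlerIntegral_comp_ofComplex f).continuousOn).add
      continuousOn_const
  have hO : IsOpen ({z : ℂ | 0 < z.im ∧ ζ z ∈ (L.lattice : Set ℂ)ᶜ} ∩
      {z : ℂ | 0 < z.im ∧ ε * s + ζ z ∈ (L.lattice : Set ℂ)ᶜ}) :=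
    (hζc.isOpen_inter_preimage isOpen_upperHalfPlaneSet L.isClosed_lattice.isOpen_compl).inter
      ((continuousOn_const.add hζc).isOpen_inter_preimage isOpen_upperHalfPlaneSet
        L.isClosed_lattice.isOpen_compl)
  have hev : ∀ᶠ z in 𝓝 z₀, ℘[L] (ε * s + ζ z) = ℘[L] (ζ z) := by
    filter_upwards [hO.mem_nhds ⟨⟨hz₀', hz₀1⟩, ⟨hz₀', hz₀2⟩⟩] with z hz
    exact hpt ⟨z, hz.1.1⟩ hz.1.2 hz.2.2
  -- Manin's lemma
  have hζan : AnalyticAt ℂ ζ z₀ :=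
    (analyticAt_const.mul (analyticAt_eichlerIntegral_comp_ofComplex f hz₀')).add analyticAt_const
  have hζnc : ¬ ∀ᶠ z in 𝓝 z₀, ζ z = ζ z₀ := by
    intro h
    apply not_eventually_const_eichlerIntegral f hf hz₀' (v z₀)
    filter_upwards [h] with z hz
    simp only [hζ] at hz
    have := mul_left_cancel₀ hε0 (add_right_cancel hz)
    simpa [hv] using this
  have hmem : ε * s ∈ L.lattice :=
    L.mem_lattice_of_weierstrassP_comp_add_eventuallyEq hζan hζnc hz₀1 hz₀2 hev
  rcases hε with rfl | rfl
  · simpa using hmem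
  · simpa using L.lattice.neg_mem hmem

/-- **The analytic bridge.**  Let `f ≠ 0` in `S₂(Γ₀(N))`, `Λ` a period pair, and `x : ℍ → ℂ` holomorphic
and `Γ₀(N)`-invariant with `x′(τ)² = (2πi f(τ))²(4x³ − g₂(Λ)x − g₃(Λ))` on `ℍ` and
`4x³ − g₂x − g₃ ≢ 0`.  Then `Λ(f) ⊆ Λ`. [cite: Manin1972, Prop. 1.4] -/
theorem periodLattice_le_of_deriv_sq (f : CuspForm (Gamma0 N) 2) (hf : f ≠ 0) (L : PeriodPair)
    (x : ℍ → ℂ) (hx : MDifferentiable 𝓘(ℂ) 𝓘(ℂ) x)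
    (hinv : ∀ (γ : Gamma0 N) (τ : ℍ), x ((γ : SL(2, ℤ)) • τ) = x τ)
    (hode : ∀ τ : ℍ, deriv (x ∘ ofComplex) τ ^ 2 =
      (2 * π * Complex.I * f τ) ^ 2 * (4 * x τ ^ 3 - L.g₂ * x τ - L.g₃))
    (hnd : ∃ τ₀ : ℍ, 4 * x τ₀ ^ 3 - L.g₂ * x τ₀ - L.g₃ ≠ 0) :
    ∀ z ∈ periodLattice f, z ∈ L.lattice := by
  intro z hz
  induction hz using AddSubgroup.closure_induction with
  | mem y hy =>
    obtain ⟨γ, rfl⟩ := hy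
    exact cuspSymbol_mem_of_deriv_sq f hf L x hx hode hnd γ (hinv γ)
  | zero => exact zero_mem _
  | add y y' _ _ hy hy' => exact add_mem hy hy'
  | neg y _ hy => exact neg_mem hy

/-! ## The level-27 instance: Ligozat's `x = η(9τ)⁴/(η(3τ)η(27τ)³)`, `u = η(3τ)³/η(27τ)³`

`x` and `u` are the tree's `etaQuotient 27 r` for the exponent vectors `expFn [(3, -1), (9, 4), (27, -3)]`
and `expFn [(3, 3), (27, -3)]`; both satisfy Newman's conditions in weight `0` (trivial character), so
they are `Γ₀(27)`-invariant holomorphic functions on `ℍ` (`etaQuotient_smul_of_mem_Gamma0`).  Ligozat's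
model of `X₀(27)` is `u² + 9u + 27 = x³` (i.e. `Z² = 4x³ − 27` with `Z = −2u − 9`: the curve `27a1`,
`c₄ = 0`, `c₆ = 216·27`), and the pull-back of its Néron differential is `dx/(2u + 9) = −2πi φ₂₇ dτ`,
`φ₂₇ = η(3τ)²η(9τ)²`.  GIVEN these two identities as identities of functions on `ℍ` (hypotheses `h1`,
`h2` below — their `q`-expansion/Sturm verification is not done in this file), the analytic bridge yields
(S2) and, with the hexagonal squeeze, `|c| = 1` on `X₀(27)`. -/

/-- Newman's conditions for `x = η(9τ)⁴/(η(3τ)η(27τ)³)` in weight `0`: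
`Σ r = 0`, `Σ δr = −48`, `Σ (27/δ) r = 0`, `∏ δ^{|r|} = 3¹⁸`. [folklore] -/
theorem newmanCond_ligozatX : NewmanCond 27 (expFn [(3, -1), (9, 4), (27, -3)]) 0 :=
  ⟨by decide, by decide, by decide, ⟨3 ^ 9, by decide⟩⟩

/-- Newman's conditions for `u = η(3τ)³/η(27τ)³` in weight `0`:
`Σ r = 0`, `Σ δr = −72`, `Σ (27/δ) r = 24`, `∏ δ^{|r|} = 3¹²`. [folklore] -/
theorem newmanCond_ligozatU : NewmanCond 27 (expFn [(3, 3), (27, -3)]) 0 :=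
  ⟨by decide, by decide, by decide, ⟨3 ^ 6, by decide⟩⟩

/-- `x(γτ) = x(τ)` for `γ ∈ Γ₀(27)`. [folklore] -/
theorem ligozatX_smul (γ : Gamma0 27) (τ : ℍ) :
    etaQuotient 27 (expFn [(3, -1), (9, 4), (27, -3)]) ((γ : SL(2, ℤ)) • τ)
      = etaQuotient 27 (expFn [(3, -1), (9, 4), (27, -3)]) τ := by
  have h := etaQuotient_smul_of_mem_Gamma0 27 (by norm_num) _ 0 ⟨0, by simp⟩ newmanCond_ligozatX γ.2 τ
  rwa [zpow_zero, one_mul] at h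

/-- `u(γτ) = u(τ)` for `γ ∈ Γ₀(27)`. [folklore] -/
theorem ligozatU_smul (γ : Gamma0 27) (τ : ℍ) :
    etaQuotient 27 (expFn [(3, 3), (27, -3)]) ((γ : SL(2, ℤ)) • τ)
      = etaQuotient 27 (expFn [(3, 3), (27, -3)]) τ := by
  have h := etaQuotient_smul_of_mem_Gamma0 27 (by norm_num) _ 0 ⟨0, by simp⟩ newmanCond_ligozatU γ.2 τ
  rwa [zpow_zero, one_mul] at h

/-- `x · q² → 1` at `i∞` (`x` has a double pole at the cusp `∞`: `Σ δ r_δ = −48 = 24·(−2)`). [folklore] -/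
theorem tendsto_ligozatX_mul_qParam_sq :
    Tendsto (fun τ : ℍ ↦ etaQuotient 27 (expFn [(3, -1), (9, 4), (27, -3)]) τ *
      Function.Periodic.qParam 1 (τ : ℂ) ^ (2 : ℤ)) atImInfty (𝓝 1) := by
  have h := tendsto_etaQuotient_div_qParam_zpow 27 (expFn [(3, -1), (9, 4), (27, -3)]) (-2) (by decide)
  refine h.congr fun τ ↦ ?_
  rw [zpow_neg, div_inv_eq_mul]

/-- Non-degeneracy: `4x(τ₀)³ − 27 ≠ 0` somewhere (indeed `|x| → ∞` at `i∞`). [folklore] -/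
theorem exists_ligozatX_nondegenerate :
    ∃ τ₀ : ℍ, 4 * etaQuotient 27 (expFn [(3, -1), (9, 4), (27, -3)]) τ₀ ^ 3
      - 0 * etaQuotient 27 (expFn [(3, -1), (9, 4), (27, -3)]) τ₀ - 27 ≠ 0 := by
  by_contra hne
  push Not at hne
  set x : ℍ → ℂ := etaQuotient 27 (expFn [(3, -1), (9, 4), (27, -3)]) with hx
  have hx3 : ∀ τ : ℍ, x τ ^ 3 = 27 / 4 := fun τ ↦ by linear_combination (1 / 4 : ℂ) * hne τ
  -- `(x q²)³ → 1`, but `(x q²)³ = (27/4) q⁶ → 0`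
  have h1 : Tendsto (fun τ : ℍ ↦ (x τ * Function.Periodic.qParam 1 (τ : ℂ) ^ (2 : ℤ)) ^ 3) atImInfty
      (𝓝 1) := by simpa using tendsto_ligozatX_mul_qParam_sq.pow 3
  have h2 : Tendsto (fun τ : ℍ ↦ (x τ * Function.Periodic.qParam 1 (τ : ℂ) ^ (2 : ℤ)) ^ 3) atImInfty
      (𝓝 0) := by
    have h6 := (tendsto_qParam_zpow_atImInfty (m := 6) (by norm_num)).const_mul (27 / 4 : ℂ)
    rw [mul_zero] at h6
    refine h6.congr fun τ ↦ ?_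
    rw [mul_pow, hx3, ← zpow_natCast, ← zpow_mul]
    norm_num
  exact one_ne_zero (tendsto_nhds_unique h1 h2)

/-- **(S2) from Ligozat's two identities.**  If `x³ = u² + 9u + 27` and `x′ = −2πi φ₂₇ (2u + 9)` hold as
identities of functions on `ℍ` (`x, u` the `η`-quotients above, `φ₂₇ = η(3τ)²η(9τ)²`), then the period
lattice of `φ₂₇` lies in the period pair with invariants `g₂ = 0`, `g₃ = 27`. [folklore] -/
theorem periodLatticeLeHex_of_etaIdentities
    (h1 : ∀ τ : ℍ, etaQuotient 27 (expFn [(3, -1), (9, 4), (27, -3)]) τ ^ 3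
      = etaQuotient 27 (expFn [(3, 3), (27, -3)]) τ ^ 2 + 9 * etaQuotient 27 (expFn [(3, 3), (27, -3)]) τ + 27)
    (h2 : ∀ τ : ℍ, deriv (etaQuotient 27 (expFn [(3, -1), (9, 4), (27, -3)]) ∘ ofComplex) τ
      = -(2 * π * Complex.I * cuspFormEtaProductTwentySeven τ)
          * (2 * etaQuotient 27 (expFn [(3, 3), (27, -3)]) τ + 9)) :
    ∃ L₁ : PeriodPair, L₁.g₂ = 0 ∧ L₁.g₃ = 27 ∧
      ∀ z ∈ periodLattice cuspFormEtaProductTwentySeven, z ∈ L₁.lattice := by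
  obtain ⟨L₁, hg2, hg3⟩ := PeriodPair.uniformization_holds 0 27 (by norm_num)
  refine ⟨L₁, hg2, hg3, periodLattice_le_of_deriv_sq cuspFormEtaProductTwentySeven
    cuspFormEtaProductTwentySeven_ne_zero L₁ _ (mdifferentiable_etaQuotient 27 _) ligozatX_smul ?_
    (by rw [hg2, hg3]; exact exists_ligozatX_nondegenerate)⟩
  intro τ
  rw [h2 τ, hg2, hg3, h1 τ]
  ring

open HexagonalSqueezeTwentySeven in
/-- **`|c| = 1` on `X₀(27)` from Ligozat's two identities** (hexagonal squeeze + analytic bridge): for every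
globally minimal `W/ℚ` and every `X₀(27)`-datum with the lattice clause, `|c(D)| = 1` — no modularity
binder, no Calegari–Dimitrov–Tang; the only analytic input left is the pair of `η`-identities. [folklore] -/
theorem abs_maninConstant_eq_one_twentySeven_of_etaIdentities
    (h1 : ∀ τ : ℍ, etaQuotient 27 (expFn [(3, -1), (9, 4), (27, -3)]) τ ^ 3
      = etaQuotient 27 (expFn [(3, 3), (27, -3)]) τ ^ 2 + 9 * etaQuotient 27 (expFn [(3, 3), (27, -3)]) τ + 27)
    (h2 : ∀ τ : ℍ, deriv (etaQuotient 27 (expFn [(3, -1), (9, 4), (27, -3)]) ∘ ofComplex) τ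
      = -(2 * π * Complex.I * cuspFormEtaProductTwentySeven τ)
          * (2 * etaQuotient 27 (expFn [(3, 3), (27, -3)]) τ + 9))
    (W : WeierstrassCurve ℚ) [W.IsGloballyMinimal] (D : ModularParametrizationData W 27)
    (hopt : ∀ z ∈ D.L.lattice, ∃ w ∈ periodLattice D.f, z = D.c * w) :
    |D.maninConstant| = 1 :=
  abs_maninConstant_eq_one_twentySeven_of_periodLattice_le_hex (periodLatticeLeHex_of_etaIdentities h1 h2)
    W D hopt

/-- C3 `ManinPrimeToThreeAtNine` at `N = 27` from Ligozat's two identities: `3 ∤ c(D)`. [folklore] -/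
theorem not_three_dvd_maninConstant_twentySeven_of_etaIdentities
    (h1 : ∀ τ : ℍ, etaQuotient 27 (expFn [(3, -1), (9, 4), (27, -3)]) τ ^ 3
      = etaQuotient 27 (expFn [(3, 3), (27, -3)]) τ ^ 2 + 9 * etaQuotient 27 (expFn [(3, 3), (27, -3)]) τ + 27)
    (h2 : ∀ τ : ℍ, deriv (etaQuotient 27 (expFn [(3, -1), (9, 4), (27, -3)]) ∘ ofComplex) τ
      = -(2 * π * Complex.I * cuspFormEtaProductTwentySeven τ)
          * (2 * etaQuotient 27 (expFn [(3, 3), (27, -3)]) τ + 9))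
    (W : WeierstrassCurve ℚ) [W.IsGloballyMinimal] (D : ModularParametrizationData W 27)
    (hopt : ∀ z ∈ D.L.lattice, ∃ w ∈ periodLattice D.f, z = D.c * w) :
    ¬ (3 : ℤ) ∣ D.maninConstant :=
  HexagonalSqueezeTwentySeven.not_three_dvd_maninConstant_twentySeven_of_periodLattice_le_hex
    (periodLatticeLeHex_of_etaIdentities h1 h2) W D hopt

end Summit.BirchSwinnertonDyer.BirchSwinnertonDyer.Theorems.ManinLocalTwoThree.AnalyticBridge

end
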